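import Mathlib.Topology.Algebra.Group.Basic
import Literature.GroupTheory.CombinatorialGroupTheory.PuncturedSurfaceGroup
import Literature.AnabelianGeometry.Anabelioids.ProSigma
import Literature.AnabelianGeometry.SemiGraphs.MorphismRigidity
import Literature.AnabelianGeometry.SemiGraphs.GaloisCountableGraphs
import Literature.AnabelianGeometry.SemiGraphs.FiniteEtaleCoveringGlobalDef
import Literature.AnabelianGeometry.SemiGraphs.FiniteEtaleCoveringVertexAligned

/-!
# Finite étale coverings of semi-graphs of anabelioids; sub-coverticial edges ([SemiAnbd] §2, pp. 23–31)

Mochizuki, *Semi-graphs of anabelioids*, Publ. RIMS **42** (2006) 221–322, §2, author's manuscript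
pp. 23–31 [cite: MochizukiSemiAnbd2006, §2 pp.23-31].  Continuing `Commensurability.lean`:

* the finite étale covering `𝒢' → 𝒢` attached to an object `G' ∈ Ob(B(𝒢))` (p. 23) and
  Definition 2.2 (i); the existence claim of p. 23 as a NAMED FACT;
* Definition 2.4 (iii): sub-coverticial / universally sub-coverticial edges, totally (universally)
  sub-coverticial; Remark 2.4.1 (second sentence; the first, "“(totally) estranged” implies
  “(totally) aloof”", is immediate when the `Π_b` are infinite and is not recorded as a fact, since
  for finite `Π_b` the literal reading of "infinite index" fails);
* Proposition 2.6 (Commensurability); Corollary 2.7 (iii); Example 2.8 (the coverticial half);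
* Example 2.10 (Stable Curves), first assertion, over an INTERFACE `IsOfSurfaceType` saying that
  each `Π_v` is "the maximal pro-`Σ` quotient of the fundamental group of a hyperbolic Riemann
  surface of finite type" (a pro-`Σ` completion of the punctured surface group `Γ_{g,r}`) and each
  `Π_b → Π_v` "the inclusion morphism of the inertia group of one of the cusps"; Remark 2.10.1;
* [IUTchI] Remark 2.5.3 (i) (T3) strictly coherent, and the claims (T3) "finite and coherent ⇒
  strictly coherent", (T4) "strictly coherent, countable ⇒ Galois-countable" as NAMED FACTS
  ((T2) Galois-countable is `GaloisCountableGraphs.lean`).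

## Rendering choices (recorded for the referee)

1. Connected components of an object `X` of a connected anabelioid (Galois category) are its
   connected subobjects: `π₀Obj X := {P : Subobject X // IsConnected P}` (`GaloisCountableGraphs.lean`).
2. p. 23 describes `𝒢'` by: vertices over `v` = connected components of `B' ×_B 𝒢_v = (𝒢_v)_{S_v}`,
   i.e. of `S_v`; edges over `e` = components of `T_e`; `𝒢'_{v'}` = the component anabelioid
   `(𝒢_v)_P`; the morphism lies over a proper morphism of semi-graphs.  We type this DESCRIPTION as a
   proposition `IsFiniteEtaleCoveringOf φ A` about a morphism `φ : 𝒢' → 𝒢` and an object `A` of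
   `B(𝒢)` (bijections of fibres with components, the constituents being the component anabelioids
   `Over P` up to equivalence, a branch of the edge of `Q ⊆ T_e` abutting to the vertex of the
   component `P ⊆ S_v` under which `Q` lies via the gluing isomorphism `ψ_b`), and Definition 2.2 (i)
   as "`∃ A`, `IsFiniteEtaleCoveringOf φ A`".  The existence of such a `𝒢'` for every `A` (p. 23
   "`B'` itself arises naturally as the `B(−)` of some … `𝒢'`") is the NAMED FACT
   `exists_finiteEtaleCovering`; the construction itself is campaign work.

Deliberately NOT here: Remark 2.2.1 (the universal pro-finite étale covering and its pro-semi-graph;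
stabilizers = images of `Π_v`, `Π_b`), Remark 2.6.1 (a concrete graph of anabelioids built from
`B(G) ⊇ B(H)` — needs `Anabelioids.bCat_galoisCategory` as data), the second and third assertions of
Example 2.10 (semi-graphs of anabelioids of pointed stable curves in characteristic `0` and `p` —
need stable curves and their dual semi-graphs), the functor `B(𝒢) → B(𝒢')` of a morphism (Remark
2.11.1), Definition 2.11 (generalized morphisms).
-/

namespace Literature.AnabelianGeometry.SemiGraphs

open CategoryTheory CategoryTheory.Limits CategoryTheory.PreGaloisCategory
open Literature.AnabelianGeometry.Anabelioids
open scoped Pointwise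

universe v₁ u₁ u

namespace SemiGraphOfAnabelioids

variable {𝒢 𝒢' : SemiGraphOfAnabelioids.{v₁, u₁, u}}

/-! ### Finite étale coverings `𝒢' → 𝒢` (p. 23, Definition 2.2 (i)) -/

/-- Transport between the edge constituents over equal edges (bookkeeping for `edgeOf (φ b) = φ e`).
[cite: MochizukiSemiAnbd2006, Def. 2.2(i) p.23] -/
noncomputable def transportE (𝒢 : SemiGraphOfAnabelioids.{v₁, u₁, u}) {e₁ e₂ : 𝒢.graph.Edge}
    (h : e₁ = e₂) : 𝒢.E e₁ ⥤ 𝒢.E e₂ := by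
  subst h
  exact 𝟭 _

/-- Transport takes the edge object `T_{e₁}` of an object of `B(𝒢)` to `T_{e₂}`.
[cite: MochizukiSemiAnbd2006, Def. 2.2(i) p.23] -/
theorem transportE_obj_T (𝒢 : SemiGraphOfAnabelioids.{v₁, u₁, u}) (A : 𝒢.BObj)
    {e₁ e₂ : 𝒢.graph.Edge} (h : e₁ = e₂) : (𝒢.transportE h).obj (A.T e₁) = A.T e₂ := by
  subst h
  rfl

/-- `φ : 𝒢' → 𝒢` *is the finite étale covering attached to* the object `A = {S_v, T_e, ψ_b}` of `B(𝒢)`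
(p. 23, rendering note 2): `φ` lies over a proper morphism; the vertices (resp. edges) of `𝔾'` over
`v` (resp. `e`) are in bijection with the connected components of `S_v` (resp. `T_e`) — recorded by
component functions `cV`, `cE` making `v' ↦ (φ v', cV v')`, `e' ↦ (φ e', cE e')` bijective; the
constituent `𝒢'_{v'}` is the component anabelioid `(𝒢_v)_P`, `P = cV v'`, with `φ_{v'}` the morphism
`(𝒢_v)_P → 𝒢_v` (pull-back `Over.star P`), similarly for edges; and a branch `b'` of `e'` abutting to
`v'` forces the component `cE e' ⊆ T_e` to lie under `b^*(cV v')` via `ψ_b` (`b = φ b'`): the arrow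
of `cE e'` factors through `b^*(P) ↪ b^* S_v ⥲ T_e`.
[cite: MochizukiSemiAnbd2006, Def. 2.2(i) p.23] -/
def Hom.IsFiniteEtaleCoveringOf (φ : Hom 𝒢' 𝒢) (A : 𝒢.BObj) : Prop :=
  SemiGraph.IsProper φ.base ∧
  ∃ (cV : ∀ v' : 𝒢'.graph.Vertex, π₀Obj (A.S (φ.base.vertexMap v')))
    (cE : ∀ e' : 𝒢'.graph.Edge, π₀Obj (A.T (φ.base.edgeMap e'))),
    Function.Bijective (fun v' : 𝒢'.graph.Vertex =>
      (⟨φ.base.vertexMap v', cV v'⟩ : Σ v, π₀Obj (A.S v))) ∧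
    Function.Bijective (fun e' : 𝒢'.graph.Edge =>
      (⟨φ.base.edgeMap e', cE e'⟩ : Σ e, π₀Obj (A.T e))) ∧
    (∀ v' : 𝒢'.graph.Vertex, ∃ α : Over ((cV v').1 : 𝒢.V (φ.base.vertexMap v')) ⥤ 𝒢'.V v',
      α.IsEquivalence ∧ Nonempty ((φ.φV v').pullback ≅ Over.star ((cV v').1 : 𝒢.V _) ⋙ α)) ∧
    (∀ e' : 𝒢'.graph.Edge, ∃ α : Over ((cE e').1 : 𝒢.E (φ.base.edgeMap e')) ⥤ 𝒢'.E e',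
      α.IsEquivalence ∧
        Nonempty ((φ.φE e' (φ.base.edgeMap e') rfl).pullback ≅ Over.star ((cE e').1 : 𝒢.E _) ⋙ α)) ∧
    ∀ (b' : 𝒢'.graph.Branch) (v' : 𝒢'.graph.Vertex) (h' : 𝒢'.graph.abuts b' = some v'),
      ∃ f : ((cE (𝒢'.graph.edgeOf b')).1 : 𝒢.E (φ.base.edgeMap (𝒢'.graph.edgeOf b'))) ⟶
          (𝒢.transportE (φ.base.edgeOf_branchMap b')).obj
            ((𝒢.pull (φ.base.branchMap b') (φ.base.vertexMap v')
              (φ.base.abuts_branchMap b' v' h')).pullback.obj ((cV v').1 : 𝒢.V (φ.base.vertexMap v'))),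
        f ≫ (𝒢.transportE (φ.base.edgeOf_branchMap b')).map
              ((𝒢.pull _ _ (φ.base.abuts_branchMap b' v' h')).pullback.map (cV v').1.arrow ≫
                (A.ψ (φ.base.branchMap b') (φ.base.vertexMap v') (φ.base.abuts_branchMap b' v' h')).hom) ≫
            eqToHom (𝒢.transportE_obj_T A (φ.base.edgeOf_branchMap b')) =
          (cE (𝒢'.graph.edgeOf b')).1.arrow

/-- `φ : 𝒢' → 𝒢` is a *finite étale covering of `𝒢`*, LOCAL half only: the local description of
p. 23 holds for some object `G'` of `B(𝒢)` (the print-facing notion, local ∧ global, is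
`IsFiniteEtaleCoveringGlobal` below; ruling κ2 / RQ13). [cite: MochizukiSemiAnbd2006, Def. 2.2(i) p.24] -/
def Hom.IsFiniteEtaleCovering (φ : Hom 𝒢' 𝒢) : Prop := ∃ A : 𝒢.BObj, φ.IsFiniteEtaleCoveringOf A

/-- `φ : 𝒢' → 𝒢` is a *finite étale covering of `𝒢`* in print's sense ([SemiAnbd] Def. 2.2 (i),
p. 23: "`B' = B(𝒢)_{G'}` … arises naturally as the `B(−)` of some … `𝒢'` equipped with a morphism
`𝒢' → 𝒢` …"): for some object `G'` of `B(𝒢)`, BOTH the local description (`IsFiniteEtaleCoveringOf`)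
the global one (`IsGlobalCoveringOf`, L3-d3: `B(𝒢') ≃ B(𝒢)_{/G'}` compatibly with `φ^*`) and branch
alignment (`IsBranchAligned`, L4-t17: the branch functors of `𝒢'` are the restrictions, not Π_v-twists
of them) and vertex alignment (`IsVertexAligned`, L6-d4: the local base points are components of the
global one) hold — the covering notion of record «local ∧ global ∧ branch-aligned ∧ vertex-aligned»
= print's constructed covering `𝒢_A` (tree-health RQ11/RQ13/RQ14, rulings κ2/μ2/π2/ρ2; none of the
extra clauses is implied by the local description). [cite: MochizukiSemiAnbd2006, Def. 2.2(i) p.23] -/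
def Hom.IsFiniteEtaleCoveringGlobal (φ : Hom 𝒢' 𝒢) : Prop :=
  ∃ A : 𝒢.BObj,
    φ.IsFiniteEtaleCoveringOf A ∧ φ.IsGlobalCoveringOf A ∧ φ.IsBranchAligned ∧ φ.IsVertexAligned

/-- NAMED FACT (p. 23): for a connected semi-graph of anabelioids `𝒢` (with at least one vertex) and
every object `G'` of `B(𝒢)`, "`B'` itself arises naturally as the `B(−)` of some … semi-graph of
anabelioids `𝒢'` equipped with a morphism `𝒢' → 𝒢` … which lies over some proper morphism of
semi-graphs" — existence of the finite étale covering attached to `G'`.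
[cite: MochizukiSemiAnbd2006, Def. 2.2(i) p.23] -/
def exists_finiteEtaleCovering : Prop :=
  ∀ (𝒢 : SemiGraphOfAnabelioids.{v₁, u₁, u}), 𝒢.IsConnected → Nonempty 𝒢.graph.Vertex →
    ∀ A : 𝒢.BObj, ∃ (𝒢' : SemiGraphOfAnabelioids.{v₁, u₁, u}) (φ : Hom 𝒢' 𝒢),
      φ.IsFiniteEtaleCoveringOf A

/-! ### Definition 2.4 (iii) and Remark 2.4.1 (pp. 25–26) -/

variable (𝒢)

/-- A closed edge `e` is *sub-coverticial* ([SemiAnbd] Def. 2.4 (iii)): "there exists a finite étale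
covering `𝒢' → 𝒢` of `𝒢` such that the underlying graph [Comments (May 2020) (14.): "underlying
semi-graph"] `𝔾'` of `𝒢'` contains a pair of distinct coverticial edges `e_a`, `e_b`, both of which
map to `e` in `𝔾`" — covering in print's (local ∧ global) sense, ruling κ2.
[cite: MochizukiSemiAnbd2006, Def. 2.4(iii) p.25] -/
def IsSubCoverticial (e : 𝒢.graph.Edge) : Prop :=
  𝒢.graph.IsClosedEdge e ∧ ∃ (𝒢' : SemiGraphOfAnabelioids.{v₁, u₁, u}) (φ : Hom 𝒢' 𝒢),
    φ.IsFiniteEtaleCoveringGlobal ∧ ∃ e₁ e₂ : 𝒢'.graph.Edge, e₁ ≠ e₂ ∧ 𝒢'.graph.Coverticial e₁ e₂ ∧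
      φ.base.edgeMap e₁ = e ∧ φ.base.edgeMap e₂ = e

/-- A closed edge `e` is *universally sub-coverticial* ([SemiAnbd] Def. 2.4 (iii)): "for every finite
étale covering `𝒢'' → 𝒢` of `𝒢`, it holds that every edge `e''` of the underlying graph [Comments (May
2020) (14.): "underlying semi-graph"] `𝔾''` of `𝒢''` that maps to `e` is sub-coverticial" — covering
in print's (local ∧ global) sense, ruling κ2. [cite: MochizukiSemiAnbd2006, Def. 2.4(iii) p.25] -/
def IsUniversallySubCoverticial (e : 𝒢.graph.Edge) : Prop :=
  𝒢.graph.IsClosedEdge e ∧ ∀ (𝒢'' : SemiGraphOfAnabelioids.{v₁, u₁, u}) (φ : Hom 𝒢'' 𝒢),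
    φ.IsFiniteEtaleCoveringGlobal →
      ∀ e'' : 𝒢''.graph.Edge, φ.base.edgeMap e'' = e → 𝒢''.IsSubCoverticial e''

/-- `𝒢` is *totally sub-coverticial*: every closed edge is sub-coverticial ([SemiAnbd] Def. 2.4
(iii)). [cite: MochizukiSemiAnbd2006, Def. 2.4(iii) p.26] -/
@[mk_iff] structure IsTotallySubCoverticial : Prop where
  /-- every closed edge is sub-coverticial -/
  isSubCoverticial : ∀ e, 𝒢.graph.IsClosedEdge e → 𝒢.IsSubCoverticial e

/-- `𝒢` is *totally universally sub-coverticial*: every closed edge is universally sub-coverticial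
([SemiAnbd] Def. 2.4 (iii)). [cite: MochizukiSemiAnbd2006, Def. 2.4(iii) p.26] -/
@[mk_iff] structure IsTotallyUniversallySubCoverticial : Prop where
  /-- every closed edge is universally sub-coverticial -/
  isUniversallySubCoverticial : ∀ e, 𝒢.graph.IsClosedEdge e → 𝒢.IsUniversallySubCoverticial e

/-- NAMED FACT, [SemiAnbd] Remark 2.4.1, second sentence: along a finite étale covering `𝒢' → 𝒢`, a
vertex (resp. edge) of `𝒢'` mapping to an elevated vertex (resp. universally sub-coverticial / aloof
/ estranged edge) is itself elevated (resp. universally sub-coverticial / aloof / estranged) —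
for coverings in print's (local ∧ global) sense, ruling κ2 (the universally-sub-coverticial clause
depends on the gluing; for the other clauses the switch only restricts to print's class).
[cite: MochizukiSemiAnbd2006, Rem. 2.4.1 p.26] -/
def remark_2_4_1_covering : Prop :=
  ∀ (𝒢 𝒢' : SemiGraphOfAnabelioids.{v₁, u₁, u}) (φ : Hom 𝒢' 𝒢), φ.IsFiniteEtaleCoveringGlobal →
    (∀ v', 𝒢.IsElevated (φ.base.vertexMap v') → 𝒢'.IsElevated v') ∧
    (∀ e', 𝒢.IsUniversallySubCoverticial (φ.base.edgeMap e') → 𝒢'.IsUniversallySubCoverticial e') ∧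
    (∀ e', 𝒢.IsAloof (φ.base.edgeMap e') → 𝒢'.IsAloof e') ∧
    ∀ e', 𝒢.IsEstranged (φ.base.edgeMap e') → 𝒢'.IsEstranged e'

/-! ### Proposition 2.6, Corollary 2.7 (iii), Example 2.8 (pp. 28–31) -/

/-- NAMED FACT, [SemiAnbd] Proposition 2.6 (Commensurability): `𝒢` a connected, quasi-coherent graph
of anabelioids, `ℍ, 𝕂 ⊆ 𝔾` connected subgraphs; "suppose that there exists a component `c` of `ℍ` that
does not belong to `𝕂` and which is either an elevated vertex or a sub-coverticial edge.  Then the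
intersection of `Π_ℍ` with any conjugate of `Π_𝕂` has infinite index in `Π_ℍ`.  In particular, no
conjugate of `Π_ℍ` is commensurable to a conjugate of `Π_𝕂`" — inside `Π_𝒢` for the basepoint through
a vertex `w` of `ℍ`, `Π_𝕂` being mapped in along any isomorphism of basepoints.
`ℍ`, `𝕂` are sub-GRAPHS of the graph `𝔾` (every branch abuts; a sub-semi-graph of `ℍ` with an
open edge refutes clause 1 as first typed — RQ10, finder L3-d1, ruling δ2).
[cite: MochizukiSemiAnbd2006, Prop. 2.6 p.28] -/
def proposition_2_6 : Prop :=
  ∀ (𝒢 : SemiGraphOfAnabelioids.{v₁, u₁, u}), 𝒢.IsConnected → 𝒢.IsGraphOfAnabelioids →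
    𝒢.IsQuasiCoherent → ∀ (H K : 𝒢.graph.Subgraph), H.toSemiGraph.IsConnected →
    K.toSemiGraph.IsConnected → H.toSemiGraph.IsGraph → K.toSemiGraph.IsGraph →
    ((∃ v, v ∈ H.verts ∧ v ∉ K.verts ∧ 𝒢.IsElevated v) ∨
      ∃ e, e ∈ H.edges ∧ e ∉ K.edges ∧ 𝒢.IsSubCoverticial e) →
    ∀ (w : H.toSemiGraph.Vertex) (F : 𝒢.V w.1 ⥤ FintypeCat.{v₁}) [FiberFunctor F]
      (w' : K.toSemiGraph.Vertex) (F' : 𝒢.V w'.1 ⥤ FintypeCat.{v₁}) [FiberFunctor F']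
      (α : 𝒢.ρ w'.1 ⋙ F' ≅ 𝒢.ρ w.1 ⋙ F),
      let PH := (𝒢.piHToPi H w F).range
      let PK := ((Aut.autMulEquivOfIso α).toMonoidHom.comp (𝒢.piHToPi K w' F')).range
      (∀ g : 𝒢.Pi w.1 F, (ConjAct.toConjAct g • PK).relIndex PH = 0) ∧
        ∀ g g' : 𝒢.Pi w.1 F,
          ¬ Subgroup.Commensurable (ConjAct.toConjAct g • PH) (ConjAct.toConjAct g' • PK)

/-- NAMED FACT, [SemiAnbd] Corollary 2.7 (iii): `𝒢`, `ℍ`, `𝕂` as in Corollary 2.7 (all vertices of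
`ℍ`, `𝕂` elevated); "suppose that every edge of `ℍ`, `𝕂` is sub-coverticial and that `Π_ℍ` is
commensurable to a conjugate of `Π_𝕂` in `Π_𝒢`.  Then `ℍ = 𝕂`."
(`ℍ`, `𝕂` sub-graphs: every branch abuts, RQ10 / ruling δ2.)
[cite: MochizukiSemiAnbd2006, Cor. 2.7(iii) p.30] -/
def corollary_2_7_iii : Prop :=
  ∀ (𝒢 : SemiGraphOfAnabelioids.{v₁, u₁, u}), 𝒢.IsConnected → 𝒢.IsGraphOfAnabelioids →
    𝒢.IsQuasiCoherent → ∀ (H K : 𝒢.graph.Subgraph), H.toSemiGraph.IsConnected →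
    K.toSemiGraph.IsConnected → H.toSemiGraph.IsGraph → K.toSemiGraph.IsGraph →
    (∀ v ∈ H.verts, 𝒢.IsElevated v) → (∀ v ∈ K.verts, 𝒢.IsElevated v) →
    (∀ e ∈ H.edges, 𝒢.IsSubCoverticial e) → (∀ e ∈ K.edges, 𝒢.IsSubCoverticial e) →
    ∀ (w : H.toSemiGraph.Vertex) (F : 𝒢.V w.1 ⥤ FintypeCat.{v₁}) [FiberFunctor F]
      (w' : K.toSemiGraph.Vertex) (F' : 𝒢.V w'.1 ⥤ FintypeCat.{v₁}) [FiberFunctor F']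
      (α : 𝒢.ρ w'.1 ⋙ F' ≅ 𝒢.ρ w.1 ⋙ F) (g : 𝒢.Pi w.1 F),
      Subgroup.Commensurable (𝒢.piHToPi H w F).range
          (ConjAct.toConjAct g •
            ((Aut.autMulEquivOfIso α).toMonoidHom.comp (𝒢.piHToPi K w' F')).range) →
        H = K

/-- NAMED FACT, [SemiAnbd] Example 2.8, coverticial half: if `𝒢_e` is trivial for all edges `e`, "a
closed edge abutting to vertices `v`, `w` is sub-coverticial (respectively, universally
sub-coverticial) if and only if both `Π_v` and `Π_w` are nontrivial (respectively, infinite)."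
[cite: MochizukiSemiAnbd2006, Ex. 2.8 p.31] -/
def example_2_8_coverticial : Prop :=
  ∀ (𝒢 : SemiGraphOfAnabelioids.{v₁, u₁, u}), 𝒢.HasTrivialEdgeAnabelioids →
    ∀ (e : 𝒢.graph.Edge) (v w : 𝒢.graph.Vertex), 𝒢.graph.Joins e v w →
      (𝒢.IsSubCoverticial e ↔
        (∀ (F : 𝒢.V v ⥤ FintypeCat.{v₁}) [FiberFunctor F], Nontrivial (Aut F)) ∧
          ∀ (F : 𝒢.V w ⥤ FintypeCat.{v₁}) [FiberFunctor F], Nontrivial (Aut F)) ∧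
      (𝒢.IsUniversallySubCoverticial e ↔
        (∀ (F : 𝒢.V v ⥤ FintypeCat.{v₁}) [FiberFunctor F], Infinite (Aut F)) ∧
          ∀ (F : 𝒢.V w ⥤ FintypeCat.{v₁}) [FiberFunctor F], Infinite (Aut F))

/-! ### Example 2.10 (Stable Curves) and Remark 2.10.1 (pp. 31–32) -/

/-- `ι : Γ → P` exhibits the topological group `P` as *the pro-`Σ` completion* of the abstract group
`Γ` (interface for [SemiAnbd] Example 2.10 "the maximal pro-`Σ` quotient of the fundamental group"):
`ι` has dense image, the open normal subgroups of `P` have `Σ`-integer index, and every normal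
subgroup of `Γ` of `Σ`-integer index is the pull-back of an open subgroup of `P`.
[cite: MochizukiSemiAnbd2006, Ex. 2.10 p.31] -/
@[mk_iff] structure IsProSigmaCompletion (Sigma : Set ℕ) {Γ : Type*} [Group Γ] {P : Type*} [Group P]
    [TopologicalSpace P] (ι : Γ →* P) : Prop where
  /-- dense image -/
  dense : Dense (Set.range ι)
  /-- `P` is pro-`Σ` -/
  index_open : ∀ N : Subgroup P, N.Normal → IsOpen (N : Set P) →
    Anabelioids.IsSigmaInteger Sigma N.index
  /-- universality: finite `Σ`-quotients of `Γ` factor continuously through `P` -/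
  comap_surj : ∀ N : Subgroup Γ, N.Normal → Anabelioids.IsSigmaInteger Sigma N.index →
    ∃ U : Subgroup P, IsOpen (U : Set P) ∧ U.comap ι = N

open Literature.GroupTheory.CombinatorialGroupTheory in
/-- INTERFACE for [SemiAnbd] Example 2.10: `𝒢` is a semi-graph of anabelioids (of injective type)
"with the property that each `Π_v` is the maximal pro-`Σ` quotient of the fundamental group of a
hyperbolic Riemann surface of finite type [a pro-`Σ` completion of some `Γ_{g,r}`, `2g − 2 + r > 0`],
and that each `Π_b → Π_v` is the inclusion morphism of the inertia group of one of the cusps", `Σ` a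
nonempty set of primes.  The cusp `js b` of a branch `b` at `v` is assigned ONCE per branch
(uniformly in the basepoint of `𝒢_e`) and DISTINCT branches at `v` get DISTINCT cusps: print says
"one of the cusps"; distinctness is the evident intent (the dual semi-graph of a pointed stable
curve attaches the branches at an irreducible component to distinct cusps of its normalisation —
a cusp inertia shared by two branches breaks total estrangement, RQ7 finding L3t1-F1 (L6-t20),
referee E5-F2). [cite: MochizukiSemiAnbd2006, Ex. 2.10 p.31] -/
@[mk_iff] structure IsOfSurfaceType (Sigma : Set ℕ) : Prop where
  /-- `Σ` is a nonempty set of prime numbers -/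
  sigma_primes : Sigma.Nonempty ∧ ∀ p ∈ Sigma, p.Prime
  /-- of injective type -/
  isOfInjectiveType : 𝒢.IsOfInjectiveType
  /-- vertex groups are pro-`Σ` surface groups; the branches at `v` are attached through the
  inertia groups of pairwise distinct cusps -/
  vertex : ∀ (v : 𝒢.graph.Vertex) (F : 𝒢.V v ⥤ FintypeCat.{v₁}) [FiberFunctor F],
    ∃ (g r : ℕ) (ι : PuncturedSurfaceGroup g r →* Aut F), PuncturedSurfaceGroup.IsHyperbolicType g r ∧
      IsProSigmaCompletion Sigma ι ∧
      ∃ js : {b : 𝒢.graph.Branch // 𝒢.graph.abuts b = some v} → Fin r, Function.Injective js ∧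
        ∀ (b : {b : 𝒢.graph.Branch // 𝒢.graph.abuts b = some v})
          (Fe : 𝒢.E (𝒢.graph.edgeOf b.1) ⥤ FintypeCat.{v₁}) [FiberFunctor Fe],
          ∃ α : (𝒢.pull b.1 v b.2).pullback ⋙ Fe ≅ F,
            (𝒢.branchSubgroup F b.1 b.2 Fe α : Set (Aut F)) =
              closure (ι '' ((PuncturedSurfaceGroup.cuspInertia (g := g) (js b) :
                Subgroup (PuncturedSurfaceGroup g r)) : Set (PuncturedSurfaceGroup g r)))

/-- NAMED FACT, [SemiAnbd] Example 2.10 (Stable Curves), first assertion: a semi-graph of anabelioids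
of surface type "is coherent, totally elevated, totally universally sub-coverticial, totally
estranged [cf. the proof of [Mzk3], Lemma 1.3.7], and verticially slim [cf. the proof of [Mzk3],
Lemma 1.3.1]" ("one verifies immediately … from the well-known structure of fundamental groups of
hyperbolic Riemann surfaces of finite type").  Hypothesis `EveryEdgeAbuts`: every node / cusp of a
pointed stable curve lies on an irreducible component ([SemiAnbd] Ex. 2.10 p. 31); without it conjunct
(1) fails on a vertexless edge (finding F-t4g3-1, ruling σ2).
[cite: MochizukiSemiAnbd2006, Ex. 2.10 p.31] -/
def example_2_10 : Prop :=
  ∀ (𝒢 : SemiGraphOfAnabelioids.{v₁, u₁, u}) (Sigma : Set ℕ), 𝒢.EveryEdgeAbuts →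
    𝒢.IsOfSurfaceType Sigma →
    𝒢.IsCoherent ∧ 𝒢.IsTotallyElevated ∧ 𝒢.IsTotallyUniversallySubCoverticial ∧
      𝒢.IsTotallyEstranged ∧ 𝒢.IsVerticiallySlim

/-- NAMED FACT, [SemiAnbd] Remark 2.10.1: "In the case of Example 2.10, it is not difficult to show,
using exactly the same techniques as those used in the proofs of Proposition 2.6, Corollary 2.7,
that `C_{Π_𝒢}(Π_b) = Π_b`" (left to the reader there; `𝒢` connected, `Π_b → Π_𝒢` for the induced
basepoints). [cite: MochizukiSemiAnbd2006, Rem. 2.10.1 p.32] -/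
def remark_2_10_1 : Prop :=
  ∀ (𝒢 : SemiGraphOfAnabelioids.{v₁, u₁, u}) (Sigma : Set ℕ), 𝒢.IsOfSurfaceType Sigma →
    𝒢.IsConnected → ∀ (b : 𝒢.graph.Branch) (v : 𝒢.graph.Vertex) (h : 𝒢.graph.abuts b = some v)
      (Fe : 𝒢.E (𝒢.graph.edgeOf b) ⥤ FintypeCat.{v₁}) [FiberFunctor Fe],
      AbsoluteAnabelian.IsCommensurablyTerminal (𝒢.piBToPi b v h Fe).range

/-! ### [IUTchI] Remark 2.5.3 (i) (T3), (T4): strictly coherent semi-graphs of anabelioids -/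

/-- `𝒢` is *strictly coherent* ([IUTchI] Remark 2.5.3 (i) (T3)): "coherent [cf. [SemiAnbd],
Definition 2.3, (iii)], and, moreover, each of the profinite groups associated to components `c` …
is topologically generated by `N` generators, for some positive integer `N` that is independent of
`c`" (for every basepoint). [cite: Mochizuki2012, IUTchI Rem. 2.5.3(i)(T3) p.53] -/
@[mk_iff] structure IsStrictlyCoherent : Prop where
  /-- coherent -/
  isCoherent : 𝒢.IsCoherent
  /-- a uniform bound on the number of topological generators -/
  exists_bound : ∃ N : ℕ, 1 ≤ N ∧
    (∀ (v : 𝒢.graph.Vertex) (F : 𝒢.V v ⥤ FintypeCat.{v₁}) [FiberFunctor F],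
      ∃ s : Finset (Aut F), s.card ≤ N ∧ (Subgroup.closure (s : Set (Aut F))).topologicalClosure = ⊤) ∧
    ∀ (e : 𝒢.graph.Edge) (F : 𝒢.E e ⥤ FintypeCat.{v₁}) [FiberFunctor F],
      ∃ s : Finset (Aut F), s.card ≤ N ∧ (Subgroup.closure (s : Set (Aut F))).topologicalClosure = ⊤

/-- NAMED FACT, [IUTchI] Remark 2.5.3 (i) (T3), last sentence: "if `𝒢` is finite and coherent, then
it is strictly coherent." [cite: Mochizuki2012, IUTchI Rem. 2.5.3(i)(T3) p.53]
[cite: MochizukiSemiAnbd2006, Comments (May 2020) (12.)(T3)] -/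
def isStrictlyCoherent_of_finite : Prop :=
  ∀ (𝒢 : SemiGraphOfAnabelioids.{v₁, u₁, u}), 𝒢.graph.IsFinite → 𝒢.IsCoherent →
    𝒢.IsStrictlyCoherent

/-- NAMED FACT, [IUTchI] Remark 2.5.3 (i) (T4): "One verifies immediately that every strictly coherent,
countable semi-graph of anabelioids is Galois-countable" — for CONNECTED `𝒢` (the setting of (T2),
where `B(𝒢)` is a connected anabelioid; over countably many isolated vertices `B(ℤ_p)` the
statement fails for honest cofinal families, G1 finding L3t7-F1 (L3-t7)).
[cite: Mochizuki2012, IUTchI Rem. 2.5.3(i)(T4) p.53]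
[cite: MochizukiSemiAnbd2006, Comments (May 2020) (12.)(T4)] -/
def isGaloisCountable_of_isStrictlyCoherent : Prop :=
  ∀ (𝒢 : SemiGraphOfAnabelioids.{v₁, u₁, u}), 𝒢.IsConnected → 𝒢.IsStrictlyCoherent →
    𝒢.graph.IsCountable → 𝒢.IsGaloisCountable

end SemiGraphOfAnabelioids

end Literature.AnabelianGeometry.SemiGraphs
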